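import Literature.NumberTheory.Transcendental.ZilberProp112Twisted
import Literature.NumberTheory.Transcendental.ZilberFieldHomogeneityProofs
import Literature.NumberTheory.Transcendental.ZilberFieldGSGC
import Literature.NumberTheory.Transcendental.ZilberFieldQuasiminimal
import Literature.NumberTheory.Transcendental.EclPredim
import Literature.ModelTheory.Quasiminimal.PartialEmbeddings
import HarnessLib

/-!
# Kirby 2010, Thm 2.1 for Zilber fields: discharge of `IsZilberField.eclIso_extension`

Proofs file for the named fact
`Literature.NumberTheory.Transcendental.IsZilberField.eclIso_extension` of
`ZilberFieldQuasiminimal.lean` (J. Kirby, *On quasiminimal excellent classes*, J. Symbolic Logic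
75 (2010), Thm 2.1, successor step, in the class of Zilber fields — B. Zilber 2005 §5,
M. Bays, J. Kirby 2013 Props 4–5, 2018 Thm 9.1): an isomorphism of exponential fields
`g : ecl(b) ≅ ecl(b')` between the closures of finite tuples of a Zilber field `K`, together
with `a ↦ a'` for `a ∉ ecl(b)`, `a' ∉ ecl(b')`, extends to an isomorphism
`ecl(b, a) ≅ ecl(b', a')`. This file **proves** it: `IsZilberField.eclIso_extension_holds`.

## Proof

The printed proof (Kirby 2010, Thm 2.1; Bays–Kirby 2013, proof of Prop. 5) is a countable
back-and-forth between `H = ecl(b, a)` and `H' = ecl(b', a')` (both countable by the countable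
closure property) through partial isomorphisms of finitely generated strong partial E-subfields
extending `g`. We render the partial isomorphisms as *twisted Γ-isomorphisms*
(`GammaField.IsGammaIsoTw`, `GammaIsoTwisted.lean`) over the isomorphism `σ : K₁⁰ ≃ K₂⁰` of base
Γ-fields induced by `g` on `K₁ = ecl(b)`, `K₂ = ecl(b')` (`ZilberHomogeneity.baseEquiv`,
`isEBaseIso_baseEquiv`), between tuples spanning strong subspaces, and run
`Literature.ModelTheory.Quasiminimal.exists_map_of_backAndForth`:

* start: `(a) ↦ (a')` (`IsGammaIsoTw.append_singleton_of_not_mem` over the empty tuple: `a`,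
  `a'` are generic over the Γ-closed `K₁`, `K₂`);
* forth (`ZilberHomogeneity.exists_forth_tw`): a point `d ∈ H` is exponentially algebraic over
  the current strong `D = K₁ + ℚc` (`H = ecl(K₁ ∪ {a})`, `a ∈ c`), hence lies in a finitely
  generated `E ⊇ D` with `δ(E/D) = 0` (`GammaField.exists_predim_le_zero_of_mem_ecl_coe`,
  `EclPredim.lean`: Khovanskii systems have predimension `≤ 0`; then minimise `δ` to make `E`
  strong); the **twisted `ℵ₀`-saturation** `GammaField.isGammaIsoTw_saturation`
  (`ZilberProp112Twisted.lean`: Bays–Kirby Prop. 11.2 over an isomorphism of bases, from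
  generic strong Γ-closedness of Zilber fields, `ZilberFieldGSGC.lean`) realises `E` over the
  other side with strong image; the image stays inside `H'` because `span H'` is Γ-closed
  (`GammaField.le_of_predim_le_zero_of_isGammaClosed`);
* back: the same with `σ⁻¹`.

The limit map is an E-field isomorphism `H ≅ H'` (polynomial and exponential relations among
finitely many points are level-`0` relations of a related pair), agrees with `g` on `ecl(b)`
(base constants are carried along `σ`, `IsGammaIsoTw.eq_of_eq_coe`) and sends `a ↦ a'`.

## References

* J. Kirby, *On quasiminimal excellent classes*, J. Symbolic Logic 75 (2010) 551–564: Thm 2.1.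
* M. Bays, J. Kirby, *Excellence and uncountable categoricity of Zilber's exponential fields*,
  arXiv:1305.0493 (2013): Lemma 3, Props 4–5.
* M. Bays, J. Kirby, *Pseudo-exponential maps, variants, and quasiminimality*, Algebra & Number
  Theory 12 (2018): Lemma 4.13, Prop. 11.2, Thm 9.1.
* B. Zilber, *Pseudo-exponentiation on algebraically closed fields of characteristic zero*,
  Ann. Pure Appl. Logic 132 (2005): §5.
-/

noncomputable section

open Set MvPolynomial

universe u

namespace Literature.NumberTheory.Transcendental

namespace ZilberHomogeneity

open GammaField Literature.ModelTheory.ExponentialFields.ExponentialRing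
  Literature.ModelTheory.Quasiminimal

variable {K : Type u} [Field K] [CharZero K] [Literature.ModelTheory.ExponentialFields.ExponentialRing K]

/-! ### The base isomorphism induced by an E-isomorphism of closed sets -/

/-- For `C` `ecl`-closed and `Λ = span ℚ C` (`= C`), the Γ-subfield `fieldOf Λ` is `C` as a set
(`ecl S` is a subfield closed under `exp`). [cite: Kirby2010QMEC, §3 (ecl-closed sets are
E-subfields)] [folklore] -/
theorem coe_fieldOf_span_ecl (S : Set K) :
    ((fieldOf (Submodule.span ℚ (ecl S)) : Set K)) = ecl S := by
  rw [(isGammaClosed_span_ecl_univ S).coe_fieldOf, coe_span_ecl]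

/-- Membership form of `coe_fieldOf_span_ecl`. [folklore] -/
theorem mem_fieldOf_span_ecl_iff (S : Set K) {z : K} :
    z ∈ fieldOf (Submodule.span ℚ (ecl S)) ↔ z ∈ ecl S := by
  rw [← SetLike.mem_coe, coe_fieldOf_span_ecl]

/-- **The isomorphism of base Γ-fields induced by an E-isomorphism `g : ecl S ≅ ecl S'`**:
`σ = g` on `fieldOf (span (ecl S)) = ecl S`. [cite: Kirby2010QMEC, Thm 2.1 (proof)] -/
def baseEquiv {g : K → K} {S S' : Set K} (hg : IsEIsoOn g (ecl S) (ecl S')) :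
    fieldOf (Submodule.span ℚ (ecl S)) ≃+* fieldOf (Submodule.span ℚ (ecl S')) where
  toFun x := ⟨g x, (mem_fieldOf_span_ecl_iff S').2 (hg.bijOn.mapsTo ((mem_fieldOf_span_ecl_iff S).1 x.2))⟩
  invFun y := ⟨Function.invFunOn g (ecl S) y,
    (mem_fieldOf_span_ecl_iff S).2 (hg.bijOn.surjOn.mapsTo_invFunOn ((mem_fieldOf_span_ecl_iff S').1 y.2))⟩
  left_inv x := Subtype.ext (hg.symm_apply_apply ((mem_fieldOf_span_ecl_iff S).1 x.2))
  right_inv y := Subtype.ext (hg.bijOn.invOn_invFunOn.2 ((mem_fieldOf_span_ecl_iff S').1 y.2))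
  map_mul' x y := Subtype.ext (hg.map_mul ((mem_fieldOf_span_ecl_iff S).1 x.2) ((mem_fieldOf_span_ecl_iff S).1 y.2))
  map_add' x y := Subtype.ext (hg.map_add ((mem_fieldOf_span_ecl_iff S).1 x.2) ((mem_fieldOf_span_ecl_iff S).1 y.2))

/-- `baseEquiv` is `g` on underlying elements. [folklore] -/
@[simp] theorem coe_baseEquiv {g : K → K} {S S' : Set K} (hg : IsEIsoOn g (ecl S) (ecl S'))
    (x : fieldOf (Submodule.span ℚ (ecl S))) : (baseEquiv hg x : K) = g x := rfl

/-- `baseEquiv` is an isomorphism of base Γ-fields (`g` maps `ecl S` onto `ecl S'` and commutes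
with `exp`). [cite: Kirby2010QMEC, Thm 2.1 (proof)] -/
theorem isEBaseIso_baseEquiv {g : K → K} {S S' : Set K} (hg : IsEIsoOn g (ecl S) (ecl S')) :
    IsEBaseIso (Submodule.span ℚ (ecl S)) (Submodule.span ℚ (ecl S')) (baseEquiv hg) where
  map_mem {x} hx := by
    rw [← SetLike.mem_coe, coe_span_ecl] at hx ⊢
    change g x ∈ ecl S'
    exact hg.bijOn.mapsTo hx
  symm_map_mem {y} hy := by
    rw [← SetLike.mem_coe, coe_span_ecl] at hy ⊢
    change Function.invFunOn g (ecl S) y ∈ ecl S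
    exact hg.bijOn.surjOn.mapsTo_invFunOn hy
  map_exp {x} hx := by
    rw [← SetLike.mem_coe, coe_span_ecl] at hx
    change g (exp x) = exp (g x)
    exact hg.map_exp hx

/-! ### Twisted Γ-isomorphisms of empty tuples -/

/-- Over any `σ`, the empty tuples are Γ-isomorphic. [folklore] -/
theorem isGammaIsoTw_elim0 {K₁ K₂ : Submodule ℚ K} (σ : fieldOf K₁ ≃+* fieldOf K₂) :
    IsGammaIsoTw σ (Fin.elim0 : Fin 0 → K) Fin.elim0 := by
  intro M P
  have hP : P = MvPolynomial.C (P.coeff 0) := MvPolynomial.eq_C_of_isEmpty P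
  rw [hP, MvPolynomial.map_C, MvPolynomial.aeval_C, MvPolynomial.aeval_C,
    map_eq_zero_iff _ (algebraMap (fieldOf K₁) K).injective,
    map_eq_zero_iff _ (algebraMap (fieldOf K₂) K).injective]
  exact (map_eq_zero_iff (σ : fieldOf K₁ →+* fieldOf K₂) (σ : fieldOf K₁ →+* fieldOf K₂).injective).symm

/-! ### Γ-algebraic extensions of strong subspaces stay inside Γ-closed subspaces -/

/-- **A finitely generated extension of predimension `≤ 0` of a strong subspace lies inside every
Γ-closed subspace containing the base** (Bays–Kirby 2018, Def. 4.9 with Lemma 4.2: otherwise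
`E + H` would be a proper finitely generated extension of `H` of predimension `≤ 0`, by
submodularity). [cite: BaysKirby2018ANT, Def. 4.9, Lemma 4.2] -/
theorem le_of_predim_le_zero_of_isGammaClosed {D E H : Submodule ℚ K} (hD : IsStrong D)
    (hH : IsGammaClosed H) (hDH : D ≤ H) (hDE : D ≤ E) (hfg : IsFG D E) (hδ : predim D E ≤ 0) :
    E ≤ H := by
  have hfgI : IsFG D (E ⊓ H) := hfg.mono inf_le_left
  have h1 : 0 ≤ predim D (E ⊓ H) := isStrong_iff.1 hD _ hfgI
  have hadd := predim_add (le_inf hDE hDH) (inf_le_left : E ⊓ H ≤ E) hfg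
  have h2 : predim (E ⊓ H) E ≤ 0 := by linarith
  have h3 : predim H (E ⊔ H) ≤ 0 := (predim_sup_le E H (hfg.of_le_left (le_inf hDE hDH))).trans h2
  have hfgH : IsFG H (E ⊔ H) := isFG_sup_right.2 (hfg.of_le_left hDH)
  have heq : E ⊔ H = H := hH le_sup_right hfgH h3
  exact le_sup_left.trans heq.le

/-! ### Forth: realising one more point over a twisted Γ-isomorphism -/

/-- **Forth step of the back-and-forth** (Kirby 2010, proof of Thm 2.1; Bays–Kirby 2013, proof
of Prop. 5). Let `K` be a Zilber field, `K₁, K₂ ≤ K` Γ-closed with an isomorphism `σ` of base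
Γ-fields, `H₁ ⊇ K₁`, `H₂ ⊇ K₂` Γ-closed subspaces, and `c ↦ c'` a Γ-isomorphism over `σ` with
`K₁ + ℚc ◁ K`, `K₂ + ℚc' ◁ K`, `c ⊆ H₁`, `c' ⊆ H₂`. Then every `d ∈ ecl(K₁ + ℚc)` is the
first coordinate of a tuple `e ⊆ H₁` such that `(c, e) ↦ (c', e')` is a Γ-isomorphism over `σ`
for some `e' ⊆ H₂`, with both extended spans strong: `d` lies in a finitely generated strong
`E ⊇ K₁ + ℚc` of predimension `0` (`GammaField.exists_predim_le_zero_of_mem_ecl_coe` and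
minimisation of `δ`), which the twisted `ℵ₀`-saturation `GammaField.isGammaIsoTw_saturation`
realises on the other side; both `E` and its image have predimension `0` over strong subspaces
of the Γ-closed `H₁`, `H₂`, hence lie inside them.
[cite: Kirby2010QMEC, Thm 2.1 (proof)] [cite: BaysKirby2013Excellence, Prop. 5 (proof)] -/
theorem exists_forth_tw [IsAlgClosed K] (hsurj : IsSurjectiveOntoUnits K)
    {K₁ K₂ : Submodule ℚ K} {σ : fieldOf K₁ ≃+* fieldOf K₂} (hσ : IsEBaseIso K₁ K₂ σ)
    (hK₁ : IsGammaClosed K₁) (hG : IsGenericallyStronglyGammaClosedOver K₂)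
    {H₁ H₂ : Submodule ℚ K} (hH₁ : IsGammaClosed H₁) (hH₂ : IsGammaClosed H₂)
    (hKH₁ : K₁ ≤ H₁) (hKH₂ : K₂ ≤ H₂) {m : ℕ} {c c' : Fin m → K} (hiso : IsGammaIsoTw σ c c')
    (hs : IsStrong (K₁ ⊔ Submodule.span ℚ (range c))) (hs' : IsStrong (K₂ ⊔ Submodule.span ℚ (range c')))
    (hcH : ∀ i, c i ∈ H₁) (hc'H : ∀ i, c' i ∈ H₂) {d : K}
    (hd : d ∈ ecl ((K₁ ⊔ Submodule.span ℚ (range c) : Submodule ℚ K) : Set K)) :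
    ∃ (k : ℕ) (e e' : Fin (k + 1) → K), e 0 = d ∧
      IsGammaIsoTw σ (Fin.append c e) (Fin.append c' e') ∧
      IsStrong (K₁ ⊔ Submodule.span ℚ (range (Fin.append c e))) ∧
      IsStrong (K₂ ⊔ Submodule.span ℚ (range (Fin.append c' e'))) ∧
      (∀ i, e i ∈ H₁) ∧ (∀ i, e' i ∈ H₂) := by
  classical
  set D := K₁ ⊔ Submodule.span ℚ (range c) with hDdef
  have hDH : D ≤ H₁ := sup_le hKH₁ (Submodule.span_le.2 (by rintro _ ⟨i, rfl⟩; exact hcH i))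
  have hD'H : K₂ ⊔ Submodule.span ℚ (range c') ≤ H₂ :=
    sup_le hKH₂ (Submodule.span_le.2 (by rintro _ ⟨i, rfl⟩; exact hc'H i))
  -- a tuple through `d` of predimension `≤ 0` over `D`
  obtain ⟨n₀, x₀, ⟨i₀, hi₀⟩, hδ₀⟩ := exists_predim_le_zero_of_mem_ecl_coe D hd
  -- minimise `δ` over finitely generated extensions of `D + ℚd`
  have hfgd : IsFG D (D ⊔ Submodule.span ℚ {d}) := isFG_sup_left.2 (isFG_span_of_finite D (finite_singleton d))
  obtain ⟨E, hdE, hfgE, -, hmin⟩ := hs.exists_forall_predim_le (fun _ => True) le_sup_left hfgd trivial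
  have hDE : D ≤ E := le_sup_left.trans hdE
  have hdmem : d ∈ E := hdE (Submodule.mem_sup_right (Submodule.mem_span_singleton_self d))
  have hEstrong : IsStrong E :=
    isStrong_of_forall_predim_le hDE hfgE fun X hX hfgX => hmin X (hdE.trans hX) hfgX trivial
  have hδE : predim D E = 0 := by
    refine le_antisymm ?_ (isStrong_iff.1 hs E hfgE)
    have h1 := hmin (D ⊔ Submodule.span ℚ (range x₀))
      (sup_le le_sup_left ((Submodule.span_singleton_le_iff_mem _ _).2
        (Submodule.mem_sup_right (Submodule.subset_span ⟨i₀, hi₀⟩))))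
      (isFG_sup_left.2 (isFG_span_of_finite D (finite_range x₀))) trivial
    rw [predim_sup_left] at h1
    exact h1.trans hδ₀
  -- generators `e = (d, s)` of `E` over `D`
  obtain ⟨s, hsE, hEle⟩ := isFG_iff_exists_finset.1 hfgE
  set e : Fin (s.card + 1) → K := Fin.cons d fun i => (s.equivFin.symm i : K) with he
  have he0 : e 0 = d := rfl
  have heE : ∀ i, e i ∈ E := by
    intro i
    refine Fin.cases ?_ (fun j => ?_) i
    · exact hdmem
    · simp only [he, Fin.cons_succ]
      exact hsE (s.equivFin.symm j).2
  have hDe : D ⊔ Submodule.span ℚ (range e) = E := by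
    refine le_antisymm (sup_le hDE (Submodule.span_le.2 (by rintro _ ⟨i, rfl⟩; exact heE i))) ?_
    refine hEle.trans (sup_le le_sup_left ((Submodule.span_mono ?_).trans le_sup_right))
    intro z hz
    refine ⟨Fin.succ (s.equivFin ⟨z, hz⟩), ?_⟩
    simp [he]
  have hδe : predim D (Submodule.span ℚ (range e)) = 0 := by
    rw [← predim_sup_left, hDe]; exact hδE
  -- twisted saturation
  obtain ⟨e', hγ, hstr', hδ'⟩ := isGammaIsoTw_saturation hsurj hK₁ hG hσ hs hs' hiso hδe
  have hrange : K₁ ⊔ Submodule.span ℚ (range (Fin.append c e)) = E := by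
    rw [range_append, Submodule.span_union, ← sup_assoc, ← hDdef, hDe]
  refine ⟨s.card, e, e', he0, hγ, by rw [hrange]; exact hEstrong, hstr', fun i => ?_, fun i => ?_⟩
  · have hEH : E ≤ H₁ := le_of_predim_le_zero_of_isGammaClosed hs hH₁ hDH hDE hfgE hδE.le
    exact hEH (heE i)
  · have hfg' : IsFG (K₂ ⊔ Submodule.span ℚ (range c'))
        ((K₂ ⊔ Submodule.span ℚ (range c')) ⊔ Submodule.span ℚ (range e')) :=
      isFG_sup_left.2 (isFG_span_of_finite _ (finite_range e'))
    have hE'H : (K₂ ⊔ Submodule.span ℚ (range c')) ⊔ Submodule.span ℚ (range e') ≤ H₂ :=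
      le_of_predim_le_zero_of_isGammaClosed hs' hH₂ hD'H le_sup_left hfg'
        (by rw [predim_sup_left]; exact hδ'.le)
    exact hE'H (Submodule.mem_sup_right (Submodule.subset_span ⟨i, rfl⟩))

/-! ### The covering relation of the back-and-forth and its symmetry -/

/-- **The back-and-forth relation**: the finite tuples `x`, `y` are *covered* by a twisted
Γ-isomorphism `c ↦ c'` over `σ` between tuples from `H₁`, `H₂` spanning strong subspaces, which
also covers the distinguished pair `(a, a')`. [cite: Kirby2010QMEC, Thm 2.1 (proof)] -/
def Covered {K₁ K₂ : Submodule ℚ K} (σ : fieldOf K₁ ≃+* fieldOf K₂) (H₁ H₂ : Submodule ℚ K) (a a' : K)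
    (n : ℕ) (x y : Fin n → K) : Prop :=
  ∃ (m : ℕ) (c c' : Fin m → K), IsGammaIsoTw σ c c' ∧
    IsStrong (K₁ ⊔ Submodule.span ℚ (range c)) ∧ IsStrong (K₂ ⊔ Submodule.span ℚ (range c')) ∧
    (∀ i, c i ∈ H₁) ∧ (∀ i, c' i ∈ H₂) ∧ (∃ i, c i = a ∧ c' i = a') ∧
    ∀ j, ∃ i, c i = x j ∧ c' i = y j

/-- Symmetry of the covering relation (invert the twisted Γ-isomorphism). [folklore] -/
theorem Covered.symm {K₁ K₂ : Submodule ℚ K} {σ : fieldOf K₁ ≃+* fieldOf K₂} {H₁ H₂ : Submodule ℚ K}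
    {a a' : K} {n : ℕ} {x y : Fin n → K} (h : Covered σ H₁ H₂ a a' n x y) :
    Covered σ.symm H₂ H₁ a' a n y x := by
  obtain ⟨m, c, c', hiso, hs, hs', hcH, hc'H, ⟨i₀, hi₀, hi₀'⟩, hcov⟩ := h
  exact ⟨m, c', c, hiso.symm, hs', hs, hc'H, hcH, ⟨i₀, hi₀', hi₀⟩,
    fun j => let ⟨i, hi, hi'⟩ := hcov j; ⟨i, hi', hi⟩⟩

/-- Related tuples have the same pattern of equal coordinates. [folklore] -/
theorem Covered.apply_eq_iff {K₁ K₂ : Submodule ℚ K} {σ : fieldOf K₁ ≃+* fieldOf K₂} {H₁ H₂ : Submodule ℚ K}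
    {a a' : K} {n : ℕ} {x y : Fin n → K} (h : Covered σ H₁ H₂ a a' n x y) (i j : Fin n) :
    x i = x j ↔ y i = y j := by
  obtain ⟨m, c, c', hiso, -, -, -, -, -, hcov⟩ := h
  obtain ⟨p, hp, hp'⟩ := hcov i
  obtain ⟨q, hq, hq'⟩ := hcov j
  rw [← hp, ← hq, ← hp', ← hq']
  exact hiso.apply_eq_iff p q

/-- **Forth for the covering relation**: a covered pair extends by any point of `H₁` on the left,
with a partner in `H₂`. [cite: Kirby2010QMEC, Thm 2.1 (proof)] -/
theorem Covered.forth [IsAlgClosed K] (hsurj : IsSurjectiveOntoUnits K)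
    {K₁ K₂ : Submodule ℚ K} {σ : fieldOf K₁ ≃+* fieldOf K₂} (hσ : IsEBaseIso K₁ K₂ σ)
    (hK₁ : IsGammaClosed K₁) (hG : IsGenericallyStronglyGammaClosedOver K₂)
    {H₁ H₂ : Submodule ℚ K} (hH₁ : IsGammaClosed H₁) (hH₂ : IsGammaClosed H₂)
    (hKH₁ : K₁ ≤ H₁) (hKH₂ : K₂ ≤ H₂) {a a' : K}
    (hHa : (H₁ : Set K) ⊆ ecl (insert a (K₁ : Set K)))
    {n : ℕ} {x y : Fin n → K} (h : Covered σ H₁ H₂ a a' n x y) {d : K} (hd : d ∈ H₁) :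
    ∃ d' ∈ H₂, Covered σ H₁ H₂ a a' (n + 1) (Fin.snoc x d) (Fin.snoc y d') := by
  obtain ⟨m, c, c', hiso, hs, hs', hcH, hc'H, ⟨i₀, hi₀, hi₀'⟩, hcov⟩ := h
  -- `d` is exponentially algebraic over `K₁ + ℚc` (which contains `a`)
  have hsub : insert a (K₁ : Set K) ⊆ ((K₁ ⊔ Submodule.span ℚ (range c) : Submodule ℚ K) : Set K) := by
    refine insert_subset ?_ fun z hz => Submodule.mem_sup_left hz
    rw [← hi₀]
    exact Submodule.mem_sup_right (Submodule.subset_span ⟨i₀, rfl⟩)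
  have hd' : d ∈ ecl ((K₁ ⊔ Submodule.span ℚ (range c) : Submodule ℚ K) : Set K) :=
    ecl_mono hsub (hHa hd)
  obtain ⟨k, e, e', he0, hγ, hse, hse', heH, he'H⟩ :=
    exists_forth_tw hsurj hσ hK₁ hG hH₁ hH₂ hKH₁ hKH₂ hiso hs hs' hcH hc'H hd'
  refine ⟨e' 0, he'H 0, m + (k + 1), Fin.append c e, Fin.append c' e', hγ, hse, hse', ?_, ?_, ?_, ?_⟩
  · intro i
    refine Fin.addCases (fun j => ?_) (fun j => ?_) i
    · simpa only [Fin.append_left] using hcH j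
    · simpa only [Fin.append_right] using heH j
  · intro i
    refine Fin.addCases (fun j => ?_) (fun j => ?_) i
    · simpa only [Fin.append_left] using hc'H j
    · simpa only [Fin.append_right] using he'H j
  · exact ⟨Fin.castAdd (k + 1) i₀, by simp [hi₀], by simp [hi₀']⟩
  · intro j
    refine Fin.lastCases ?_ (fun j' => ?_) j
    · exact ⟨Fin.natAdd m 0, by simp [he0], by simp⟩
    · obtain ⟨i, hi, hi'⟩ := hcov j'
      exact ⟨Fin.castAdd (k + 1) i, by simp [hi], by simp [hi']⟩

/-! ### Level-`0` relations of covered points -/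

section Relations

variable {K₁ K₂ : Submodule ℚ K} {σ : fieldOf K₁ ≃+* fieldOf K₂} {m : ℕ} {c c' : Fin m → K}

/-- Additive relations among coordinates transfer along a twisted Γ-isomorphism. [folklore] -/
theorem _root_.Literature.NumberTheory.Transcendental.GammaField.IsGammaIsoTw.add_eq
    (hiso : IsGammaIsoTw σ c c') {i j k : Fin m} (h : c i + c j = c k) : c' i + c' j = c' k := by
  have := hiso 0 (X (Sum.inl i) + X (Sum.inl j) - X (Sum.inl k))
  simp only [map_add, map_sub, MvPolynomial.map_X, MvPolynomial.aeval_X, lvGens_inl, sub_eq_zero] at this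
  exact this.1 h

/-- Multiplicative relations among coordinates transfer along a twisted Γ-isomorphism. [folklore] -/
theorem _root_.Literature.NumberTheory.Transcendental.GammaField.IsGammaIsoTw.mul_eq
    (hiso : IsGammaIsoTw σ c c') {i j k : Fin m} (h : c i * c j = c k) : c' i * c' j = c' k := by
  have := hiso 0 (X (Sum.inl i) * X (Sum.inl j) - X (Sum.inl k))
  simp only [map_mul, map_sub, MvPolynomial.map_X, MvPolynomial.aeval_X, lvGens_inl, sub_eq_zero] at this
  exact this.1 h

/-- Exponential relations among coordinates transfer along a twisted Γ-isomorphism. [folklore] -/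
theorem _root_.Literature.NumberTheory.Transcendental.GammaField.IsGammaIsoTw.exp_eq
    (hiso : IsGammaIsoTw σ c c') {i k : Fin m} (h : exp (c i) = c k) : exp (c' i) = c' k := by
  have := hiso 0 (X (Sum.inr i) - X (Sum.inl k))
  simp only [map_sub, MvPolynomial.map_X, MvPolynomial.aeval_X, lvGens_inl, lvGens_zero_inr,
    sub_eq_zero] at this
  exact this.1 h

end Relations

/-! ### The theorem -/

set_option maxHeartbeats 400000 in
/-- **Kirby 2010, Thm 2.1 for Zilber fields** — discharge of the named fact
`IsZilberField.eclIso_extension` (`ZilberFieldQuasiminimal.lean`): for a Zilber field `K`,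
finite tuples `b`, `b'`, an isomorphism of exponential fields `g : ecl(b) ≅ ecl(b')`, and
`a ∉ ecl(b)`, `a' ∉ ecl(b')`, the map `g ∪ {(a, a')}` extends to an isomorphism of exponential
fields `ecl(b, a) ≅ ecl(b', a')`. Proof: countable back-and-forth
(`Literature.ModelTheory.Quasiminimal.exists_map_of_backAndForth`) between the countable
closures `ecl(b, a)`, `ecl(b', a')` through the covering relation `Covered` of twisted
Γ-isomorphisms over the base isomorphism induced by `g` (`baseEquiv`), started at `(a) ↦ (a')`
(both generic over the Γ-closed `ecl(b)`, `ecl(b')`: `IsGammaIsoTw.append_singleton_of_not_mem`)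
and extended by `Covered.forth` on both sides (twisted `ℵ₀`-saturation,
`GammaField.isGammaIsoTw_saturation`, from generic strong Γ-closedness of Zilber fields); the
limit map preserves `+`, `·`, `exp` (level-`0` relations of related tuples), is `g` on `ecl(b)`
(`IsGammaIsoTw.eq_of_eq_coe`) and sends `a ↦ a'`.
[cite: Kirby2010QMEC, Thm 2.1] [cite: BaysKirby2013Excellence, Prop. 4 and Prop. 5]
[cite: BaysKirby2018ANT, Thm 9.1, Prop. 11.2] [cite: Zilber2005PseudoExp, §5 and Thm 1.2] -/
theorem _root_.Literature.NumberTheory.Transcendental.IsZilberField.eclIso_extension_holds :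
    IsZilberField.eclIso_extension.{u} := by
  intro K _ _ _ hK m n b b' g hg a a' ha ha'
  classical
  haveI := hK.isAlgClosed
  have hsurj := hK.isSurjectiveOntoUnits
  have hccp := hK.hasCountableClosureProperty
  -- the bases and the closures
  set K₁ : Submodule ℚ K := Submodule.span ℚ (ecl (range b)) with hK₁def
  set K₂ : Submodule ℚ K := Submodule.span ℚ (ecl (range b')) with hK₂def
  set H₁ : Submodule ℚ K := Submodule.span ℚ (ecl (insert a (range b))) with hH₁def
  set H₂ : Submodule ℚ K := Submodule.span ℚ (ecl (insert a' (range b'))) with hH₂def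
  have hK₁ : IsGammaClosed K₁ := isGammaClosed_span_ecl_univ _
  have hK₂ : IsGammaClosed K₂ := isGammaClosed_span_ecl_univ _
  have hH₁ : IsGammaClosed H₁ := isGammaClosed_span_ecl_univ _
  have hH₂ : IsGammaClosed H₂ := isGammaClosed_span_ecl_univ _
  have hG₁ : IsGenericallyStronglyGammaClosedOver K₁ :=
    ZilberGSGC.isGenericallyStronglyGammaClosedOver_of_isStronglyExpAlgClosed hK.isStronglyExpAlgClosed K₁
  have hG₂ : IsGenericallyStronglyGammaClosedOver K₂ :=
    ZilberGSGC.isGenericallyStronglyGammaClosedOver_of_isStronglyExpAlgClosed hK.isStronglyExpAlgClosed K₂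
  have hmemK₁ : ∀ {z : K}, z ∈ K₁ ↔ z ∈ ecl (range b) := fun {z} => by
    rw [← SetLike.mem_coe, hK₁def, coe_span_ecl]
  have hmemK₂ : ∀ {z : K}, z ∈ K₂ ↔ z ∈ ecl (range b') := fun {z} => by
    rw [← SetLike.mem_coe, hK₂def, coe_span_ecl]
  have hmemH₁ : ∀ {z : K}, z ∈ H₁ ↔ z ∈ ecl (insert a (range b)) := fun {z} => by
    rw [← SetLike.mem_coe, hH₁def, coe_span_ecl]
  have hmemH₂ : ∀ {z : K}, z ∈ H₂ ↔ z ∈ ecl (insert a' (range b')) := fun {z} => by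
    rw [← SetLike.mem_coe, hH₂def, coe_span_ecl]
  have hKH₁ : K₁ ≤ H₁ := fun z hz => hmemH₁.2 (ecl_mono (subset_insert _ _) (hmemK₁.1 hz))
  have hKH₂ : K₂ ≤ H₂ := fun z hz => hmemH₂.2 (ecl_mono (subset_insert _ _) (hmemK₂.1 hz))
  have haH₁ : a ∈ H₁ := hmemH₁.2 (subset_ecl _ (mem_insert _ _))
  have haH₂ : a' ∈ H₂ := hmemH₂.2 (subset_ecl _ (mem_insert _ _))
  have hHa₁ : (H₁ : Set K) ⊆ ecl (insert a (K₁ : Set K)) := by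
    intro z hz
    rw [SetLike.mem_coe, hmemH₁] at hz
    refine ecl_mono (insert_subset_insert fun w hw => ?_) hz
    rw [SetLike.mem_coe, hmemK₁]; exact subset_ecl _ hw
  have hHa₂ : (H₂ : Set K) ⊆ ecl (insert a' (K₂ : Set K)) := by
    intro z hz
    rw [SetLike.mem_coe, hmemH₂] at hz
    refine ecl_mono (insert_subset_insert fun w hw => ?_) hz
    rw [SetLike.mem_coe, hmemK₂]; exact subset_ecl _ hw
  -- the base isomorphism
  set σ := baseEquiv hg with hσdef
  have hσ : IsEBaseIso K₁ K₂ σ := isEBaseIso_baseEquiv hg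
  -- the starting pair `(a) ↦ (a')`
  have haK₁ : a ∉ K₁ := fun h => ha (hmemK₁.1 h)
  have haK₂ : a' ∉ K₂ := fun h => ha' (hmemK₂.1 h)
  have hstart : Covered σ H₁ H₂ a a' 0 Fin.elim0 Fin.elim0 := by
    have h0 := isGammaIsoTw_elim0 (K := K) σ
    have he0 : range (Fin.elim0 : Fin 0 → K) = ∅ := Set.range_eq_empty _
    have hs₁ : IsStrong (K₁ ⊔ Submodule.span ℚ (range (Fin.elim0 : Fin 0 → K))) := by
      rw [he0, Submodule.span_empty, sup_bot_eq]; exact hK₁.isStrong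
    have hs₂ : IsStrong (K₂ ⊔ Submodule.span ℚ (range (Fin.elim0 : Fin 0 → K))) := by
      rw [he0, Submodule.span_empty, sup_bot_eq]; exact hK₂.isStrong
    obtain ⟨hγ, hst₁, hst₂⟩ := h0.append_singleton_of_not_mem hs₁ hs₂ hK₁ hK₂
      (by rw [he0, Submodule.span_empty, sup_bot_eq])
      (by rw [he0, Submodule.span_empty, sup_bot_eq]) haK₁ haK₂
    refine ⟨0 + 1, Fin.append Fin.elim0 ![a], Fin.append Fin.elim0 ![a'], hγ, hst₁, hst₂,
      fun i => ?_, fun i => ?_, ⟨Fin.natAdd 0 0, by simp, by simp⟩, fun j => j.elim0⟩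
    · refine Fin.addCases (fun j => j.elim0) (fun j => ?_) i
      rw [Fin.append_right, Fin.fin_one_eq_zero j]; exact haH₁
    · refine Fin.addCases (fun j => j.elim0) (fun j => ?_) i
      rw [Fin.append_right, Fin.fin_one_eq_zero j]; exact haH₂
  -- countability
  have hC₁ : ((H₁ : Set K)).Countable := countable_span_ecl hccp ((finite_range b).insert a).countable
  have hC₂ : ((H₂ : Set K)).Countable := countable_span_ecl hccp ((finite_range b').insert a').countable
  -- the back-and-forth
  obtain ⟨g', himg, hcov⟩ := exists_map_of_backAndForth (M := K)
    (S := fun n x y => Covered σ H₁ H₂ a a' n x y) (C := (H₁ : Set K)) (C' := (H₂ : Set K)) hC₁ hC₂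
    hstart (fun n x y h i j => h.apply_eq_iff i j)
    (fun n x y h _ _ d hd => Covered.forth hsurj hσ hK₁ hG₂ hH₁ hH₂ hKH₁ hKH₂ hHa₁ h hd)
    (fun n x y h _ _ d hd => by
      obtain ⟨d₀, hd₀, hcov⟩ := Covered.forth hsurj hσ.symm hK₂ hG₁ hH₂ hH₁ hKH₂ hKH₁ hHa₂ h.symm hd
      refine ⟨d₀, hd₀, ?_⟩
      have := hcov.symm
      rwa [RingEquiv.symm_symm] at this)
  -- extracting a covering pair for finitely many points of `H₁`
  have hpair : ∀ {k : ℕ} (τ : Fin k → K), (∀ i, τ i ∈ H₁) →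
      ∃ (m : ℕ) (c c' : Fin m → K), IsGammaIsoTw σ c c' ∧ (∃ i, c i = a ∧ c' i = a') ∧
        ∀ j, ∃ i, c i = τ j ∧ c' i = g' (τ j) := by
    intro k τ hτ
    obtain ⟨n₀, x, y, hS, -, -, ι, hx, hy⟩ := hcov τ hτ
    obtain ⟨m', c, c', hiso, -, -, -, -, hia, hcv⟩ := hS
    refine ⟨m', c, c', hiso, hia, fun j => ?_⟩
    obtain ⟨i, hi, hi'⟩ := hcv (ι j)
    exact ⟨i, by rw [hi]; exact congrFun hx j, by rw [hi']; exact congrFun hy j⟩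
  -- the closures are E-subfields
  have hHadd : ∀ {u v : K}, u ∈ (H₁ : Set K) → v ∈ (H₁ : Set K) → u + v ∈ (H₁ : Set K) := by
    intro u v hu hv
    rw [SetLike.mem_coe, hmemH₁] at hu hv ⊢
    exact Khovanskii.add_mem_ecl hu hv
  have hHmul : ∀ {u v : K}, u ∈ (H₁ : Set K) → v ∈ (H₁ : Set K) → u * v ∈ (H₁ : Set K) := by
    intro u v hu hv
    rw [SetLike.mem_coe, hmemH₁] at hu hv ⊢
    exact Khovanskii.mul_mem_ecl hu hv
  have hHexp : ∀ {u : K}, u ∈ (H₁ : Set K) → exp u ∈ (H₁ : Set K) := by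
    intro u hu
    rw [SetLike.mem_coe, hmemH₁] at hu ⊢
    exact Khovanskii.exp_mem_ecl hu
  -- conclusion
  have hHset₁ : ((H₁ : Set K)) = ecl (insert a (range b)) := by rw [hH₁def, coe_span_ecl]
  have hHset₂ : ((H₂ : Set K)) = ecl (insert a' (range b')) := by rw [hH₂def, coe_span_ecl]
  refine ⟨g', ?_, ?_, ?_⟩
  · rw [← hHset₁, ← hHset₂]
    refine ⟨⟨?_, ?_, ?_⟩, ?_, ?_, ?_⟩
    · intro z hz
      rw [← himg]; exact mem_image_of_mem g' hz
    · intro p hp q hq hpq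
      obtain ⟨m', c, c', hiso, -, hcv⟩ := hpair ![p, q] (fun i => by fin_cases i <;> assumption)
      obtain ⟨i, hi, hi'⟩ := hcv 0
      obtain ⟨j, hj, hj'⟩ := hcv 1
      simp only [Matrix.cons_val_zero, Matrix.cons_val_one] at hi hi' hj hj'
      have := (hiso.apply_eq_iff i j).2 (by rw [hi', hj', hpq])
      rwa [hi, hj] at this
    · rw [← himg]; exact surjOn_image g' _
    · intro u v hu hv
      obtain ⟨m', c, c', hiso, -, hcv⟩ := hpair ![u, v, u + v]
        (fun i => by fin_cases i <;> [exact hu; exact hv; exact hHadd hu hv])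
      obtain ⟨i, hi, hi'⟩ := hcv 0
      obtain ⟨j, hj, hj'⟩ := hcv 1
      obtain ⟨k, hk, hk'⟩ := hcv 2
      simp only [Matrix.cons_val_zero, Matrix.cons_val_one, Matrix.head_cons, Matrix.cons_val_two,
        Matrix.tail_cons] at hi hi' hj hj' hk hk'
      have := hiso.add_eq (i := i) (j := j) (k := k) (by rw [hi, hj, hk])
      rw [hi', hj', hk'] at this
      exact this.symm
    · intro u v hu hv
      obtain ⟨m', c, c', hiso, -, hcv⟩ := hpair ![u, v, u * v]
        (fun i => by fin_cases i <;> [exact hu; exact hv; exact hHmul hu hv])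
      obtain ⟨i, hi, hi'⟩ := hcv 0
      obtain ⟨j, hj, hj'⟩ := hcv 1
      obtain ⟨k, hk, hk'⟩ := hcv 2
      simp only [Matrix.cons_val_zero, Matrix.cons_val_one, Matrix.head_cons, Matrix.cons_val_two,
        Matrix.tail_cons] at hi hi' hj hj' hk hk'
      have := hiso.mul_eq (i := i) (j := j) (k := k) (by rw [hi, hj, hk])
      rw [hi', hj', hk'] at this
      exact this.symm
    · intro u hu
      obtain ⟨m', c, c', hiso, -, hcv⟩ := hpair ![u, exp u]
        (fun i => by fin_cases i <;> [exact hu; exact hHexp hu])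
      obtain ⟨i, hi, hi'⟩ := hcv 0
      obtain ⟨k, hk, hk'⟩ := hcv 1
      simp only [Matrix.cons_val_zero, Matrix.cons_val_one] at hi hi' hk hk'
      have := hiso.exp_eq (i := i) (k := k) (by rw [hi, hk])
      rw [hi', hk'] at this
      exact this.symm
  · -- `g' = g` on `ecl b`
    intro z hz
    have hzK : z ∈ K₁ := hmemK₁.2 hz
    obtain ⟨m', c, c', hiso, -, hcv⟩ := hpair ![z] (fun i => by fin_cases i; exact hKH₁ hzK)
    obtain ⟨i, hi, hi'⟩ := hcv 0
    simp only [Matrix.cons_val_zero] at hi hi'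
    have hzF : z ∈ fieldOf K₁ := mem_fieldOf_of_mem hzK
    have := hiso.eq_of_eq_coe (i := i) (k := ⟨z, hzF⟩) hi
    rw [hi'] at this
    rw [this, hσdef, coe_baseEquiv]
  · -- `g' a = a'`
    obtain ⟨m', c, c', hiso, ⟨i₀, hi₀, hi₀'⟩, hcv⟩ := hpair ![a] (fun i => by fin_cases i; exact haH₁)
    obtain ⟨i, hi, hi'⟩ := hcv 0
    simp only [Matrix.cons_val_zero] at hi hi'
    have := (hiso.apply_eq_iff i₀ i).1 (by rw [hi₀, hi])
    rw [hi₀', hi'] at this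
    exact this.symm

end ZilberHomogeneity

end Literature.NumberTheory.Transcendental
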